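import Literature.AlgebraicGeometry.Resolution.NodalPowRingSingularLocus
import Literature.AlgebraicGeometry.Resolution.PowerSeriesRegularLocal
import Literature.AlgebraicGeometry.Resolution.RegularLocalRingsUFD
import Literature.AlgebraicGeometry.Resolution.StalkIdealLemmas
import Literature.AlgebraicGeometry.Resolution.AlterationsFormalNodesRegular
import HarnessLib

/-!
# The formal model `k⟦u, v, t₁, …, t_m⟧/(uv - t₁ ⋯ t_s)` of de Jong 4.25 (ii) is an integral domain

Topic: `Literature/AlgebraicGeometry/Resolution`. Commutative algebra underneath the chart
computation of de Jong 1996, Claim 4.27 (`DeJong1996NodalBlowupFormalCharts`,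
`AlterationsNormalFormBlowupChartsFormal.lean`), whose singular charts are again rings of the shape
`k⟦u, v, t⟧/(uv - t₁ ⋯ t_{s'})` ("Clearly the singularities are of the type described in (ii)",
p. 76): to recognise a complete local ring as such a ring one maps the model onto it and needs the
model to be an integral domain (of dimension `m + 1`). Everything here is PROVED:

* `MvPowerSeries.constantCoeff_killCompl`, `MvPowerSeries.isUnit_killCompl_iff`,
  `MvPowerSeries.killCompl_killCompl` — bookkeeping for Mathlib's "kill some variables" maps
  `MvPowerSeries.killCompl`;
* `MvPowerSeries.prime_X'`, `MvPowerSeries.X_dvd_X_iff`, `MvPowerSeries.X_dvd_prod_X_iff` —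
  the variables of `k⟦X⟧` are pairwise non-associated primes;
* `MvPowerSeries.prime_X_mul_X_sub_prod` — **`X_u X_v - ∏_{c ∈ T} X_c` is a prime element of
  `k⟦Xᵢ : i ∈ σ⟧`** (`σ` finite, `u ≠ v` outside the non-empty `T`). Since `k⟦X⟧` is factorial
  (a regular local ring: Auslander–Buchsbaum, `IsRegularLocalRing.uniqueFactorizationMonoid`) it
  suffices to show irreducibility. If `F = GH` with `G`, `H` non-units, killing `X_u, X_v` gives
  `G₀H₀ = -∏ X_c`, so some `X_j`, `j ∈ T`, does not divide `G₀` (else `∏ X_c ∣ G₀` and `H₀`,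
  hence `H`, would be a unit); killing `X_j` instead gives `ḠH̄ = X_u X_v` with `Ḡ, H̄`
  non-units, whence `X_u ∣ Ḡ` or `X_v ∣ Ḡ`, and killing `X_u, X_v` as well, `X_j ∣ G₀` — a
  contradiction;
* `DeJong1996.prime_nodalFamilyRelation`, `DeJong1996.NodalFamilyRing.isDomain` — hence
  `uv - t₁ ⋯ t_s` is prime in `k⟦u, v, t₁, …, t_m⟧` and the formal model
  `DeJong1996.NodalFamilyRing k m s` is an integral domain, for `1 ≤ s ≤ m`;
* `DeJong1996.NodalFamilyRing.ringKrullDim_le` (`dim ≤ m + 1`, from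
  `FormalNodeRing.ringKrullDim_le`) and `DeJong1996.NodalFamilyRing.not_isRegularLocalRing` (for
  `s ≥ 2` the model is NOT regular: "`x` is a singular point", from
  `FormalNodeRing.exists_eq_single_of_isRegularLocalRing`).

## Sources

* A. J. de Jong, *Smoothness, semi-stability and alterations*, Publ. Math. IHÉS 83 (1996),
  4.25 (ii), 4.27 (pp. 75–76). [DeJong1996]
* H. Matsumura, *Commutative Ring Theory* (1986), Thm. 20.3 (regular local rings are UFDs), via
  `RegularLocalRingsUFD.lean`. [Matsumura1987]
-/

noncomputable section

namespace Literature.AlgebraicGeometry.Resolution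

universe u

open IsLocalRing

/-! ## Killing variables: bookkeeping -/

section KillCompl

variable {σ τ υ : Type*} {R : Type*} [CommRing R]

/-- Killing variables does not change the constant coefficient. [folklore] -/
theorem MvPowerSeries.constantCoeff_killCompl (e : τ ↪ σ) (p : MvPowerSeries σ R) :
    MvPowerSeries.constantCoeff (MvPowerSeries.killCompl e p) = MvPowerSeries.constantCoeff p := by
  rw [← MvPowerSeries.coeff_zero_eq_constantCoeff_apply, MvPowerSeries.coeff_killCompl,
    Finsupp.embDomain_zero, MvPowerSeries.coeff_zero_eq_constantCoeff_apply]

/-- Over a field, killing variables preserves and reflects units. [folklore] -/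
theorem MvPowerSeries.isUnit_killCompl_iff {k : Type*} [Field k] (e : τ ↪ σ)
    (p : MvPowerSeries σ k) : IsUnit (MvPowerSeries.killCompl e p) ↔ IsUnit p := by
  rw [MvPowerSeries.isUnit_iff_constantCoeff, MvPowerSeries.isUnit_iff_constantCoeff,
    MvPowerSeries.constantCoeff_killCompl]

/-- Killing variables in two steps is killing them at once. [folklore] -/
theorem MvPowerSeries.killCompl_killCompl (e : τ ↪ σ) (e' : υ ↪ τ) (p : MvPowerSeries σ R) :
    MvPowerSeries.killCompl e' (MvPowerSeries.killCompl e p) =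
      MvPowerSeries.killCompl (e'.trans e) p := by
  ext x
  rw [MvPowerSeries.coeff_killCompl, MvPowerSeries.coeff_killCompl, MvPowerSeries.coeff_killCompl,
    Finsupp.embDomain_trans_apply]

end KillCompl

/-! ## The variables are pairwise non-associated primes -/

section Variables

variable {σ : Type*} (k : Type*) [Field k]

/-- A variable of `k⟦Xᵢ : i ∈ σ⟧` is a prime element. [folklore] -/
theorem MvPowerSeries.prime_X' [DecidableEq σ] (i : σ) : Prime (MvPowerSeries.X i : MvPowerSeries σ k) := by
  have hne : (MvPowerSeries.X i : MvPowerSeries σ k) ≠ 0 := by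
    intro h
    have := congrArg (MvPowerSeries.coeff (Finsupp.single i 1)) h
    rw [MvPowerSeries.coeff_X, if_pos rfl, MvPowerSeries.coeff_zero] at this
    exact one_ne_zero this
  rw [← Ideal.span_singleton_prime hne]
  have h := MvPowerSeries.isPrime_span_X_image (R := k) (Function.Embedding.subtype (· ≠ i)) {i}
    (fun s => by
      simp only [Finset.mem_singleton, Set.mem_range, Function.Embedding.coe_subtype, not_exists]
      constructor
      · rintro rfl ⟨x, hx⟩ h
        exact hx h
      · intro h
        by_contra hs
        exact h ⟨s, hs⟩ rfl)
  simpa using h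

variable {k}

/-- Distinct variables do not divide each other. [folklore] -/
theorem MvPowerSeries.X_dvd_X_iff [DecidableEq σ] {i j : σ} :
    (MvPowerSeries.X i : MvPowerSeries σ k) ∣ MvPowerSeries.X j ↔ i = j := by
  constructor
  · intro h
    by_contra hij
    have h1 := (MvPowerSeries.X_dvd_iff.mp h) (Finsupp.single j 1) (by simp [Ne.symm hij])
    rw [MvPowerSeries.coeff_X, if_pos rfl] at h1
    exact one_ne_zero h1
  · rintro rfl
    rfl

/-- A variable divides a product of distinct variables iff it occurs in it. [folklore] -/
theorem MvPowerSeries.X_dvd_prod_X_iff [DecidableEq σ] {i : σ} {T : Finset σ} :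
    (MvPowerSeries.X i : MvPowerSeries σ k) ∣ ∏ c ∈ T, MvPowerSeries.X c ↔ i ∈ T := by
  constructor
  · intro h
    obtain ⟨c, hc, hic⟩ := (MvPowerSeries.prime_X' k i).exists_mem_finset_dvd h
    rwa [MvPowerSeries.X_dvd_X_iff.mp hic]
  · intro hi
    exact Finset.dvd_prod_of_mem _ hi

/-- If every variable of `T` divides `G`, so does their product. [folklore] -/
theorem MvPowerSeries.prod_X_dvd_of_forall [DecidableEq σ] {T : Finset σ} {G : MvPowerSeries σ k}
    (h : ∀ c ∈ T, (MvPowerSeries.X c : MvPowerSeries σ k) ∣ G) : (∏ c ∈ T, MvPowerSeries.X c) ∣ G :=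
  Finset.prod_dvd_of_forall_dvd_of_pairwise (fun c => (MvPowerSeries.X c : MvPowerSeries σ k)) T
    (fun c _ => MvPowerSeries.prime_X' k c)
    (fun _ _ _ _ hcc' h => hcc' (MvPowerSeries.X_dvd_X_iff.mp h)) h

end Variables

/-! ## `X_u X_v - ∏_{c ∈ T} X_c` is prime -/

section Prime

variable {σ : Type*} [Fintype σ] [DecidableEq σ] (k : Type*) [Field k]

/-- **`F = X_u X_v - ∏_{c ∈ T} X_c` is a prime element of `k⟦Xᵢ : i ∈ σ⟧`** for `σ` finite,
`u ≠ v` not in the non-empty finset `T`. See the module docstring for the proof (irreducibility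
by killing variables; `k⟦X⟧` is factorial). [cite: Matsumura1987, Thm. 20.3] -/
theorem MvPowerSeries.prime_X_mul_X_sub_prod (u v : σ) (huv : u ≠ v) (T : Finset σ)
    (hT : T.Nonempty) (huT : u ∉ T) (hvT : v ∉ T) :
    Prime (MvPowerSeries.X u * MvPowerSeries.X v - ∏ c ∈ T, MvPowerSeries.X c :
      MvPowerSeries σ k) := by
  haveI := isRegularLocalRing_mvPowerSeries k σ
  haveI : UniqueFactorizationMonoid (MvPowerSeries σ k) :=
    IsRegularLocalRing.uniqueFactorizationMonoid (MvPowerSeries σ k)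
  set F : MvPowerSeries σ k := MvPowerSeries.X u * MvPowerSeries.X v - ∏ c ∈ T, MvPowerSeries.X c
    with hF
  -- `F` is not a unit
  have hFu : ¬ IsUnit F := by
    obtain ⟨c₀, hc₀⟩ := hT
    rw [MvPowerSeries.isUnit_iff_constantCoeff, hF, map_sub, map_mul, MvPowerSeries.constantCoeff_X,
      zero_mul, map_prod, Finset.prod_eq_zero hc₀ (MvPowerSeries.constantCoeff_X c₀), sub_zero]
    exact not_isUnit_zero
  refine UniqueFactorizationMonoid.irreducible_iff_prime.mp ⟨hFu, fun G H hGH => ?_⟩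
  by_contra hcon
  rw [not_or] at hcon
  obtain ⟨hG, hH⟩ := hcon
  -- kill `X_u` and `X_v`
  let e₀ : {c // c ≠ u ∧ c ≠ v} ↪ σ := Function.Embedding.subtype _
  let κ₀ := MvPowerSeries.killCompl (R := k) e₀
  have hκ₀u : κ₀ (MvPowerSeries.X u) = 0 :=
    MvPowerSeries.killCompl_X_eq_zero (by rintro ⟨⟨c, hc⟩, h⟩; exact hc.1 h)
  have hκ₀v : κ₀ (MvPowerSeries.X v) = 0 :=
    MvPowerSeries.killCompl_X_eq_zero (by rintro ⟨⟨c, hc⟩, h⟩; exact hc.2 h)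
  have hκ₀c : ∀ c (hc : c ∈ T), κ₀ (MvPowerSeries.X c) =
      MvPowerSeries.X ⟨c, fun h => huT (h ▸ hc), fun h => hvT (h ▸ hc)⟩ := by
    intro c hc
    exact MvPowerSeries.killCompl_X (R := k) (e := e₀) ⟨c, _⟩
  set P₀ : MvPowerSeries {c // c ≠ u ∧ c ≠ v} k := ∏ c ∈ T, κ₀ (MvPowerSeries.X c) with hP₀
  have hκ₀F : κ₀ F = -P₀ := by
    rw [hF, map_sub, map_mul, hκ₀u, zero_mul, zero_sub, map_prod]
  have hP₀ne : P₀ ≠ 0 := by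
    rw [hP₀, Finset.prod_ne_zero_iff]
    intro c hc
    rw [hκ₀c c hc]
    exact (MvPowerSeries.prime_X' k _).ne_zero
  have hGH₀ : κ₀ G * κ₀ H = -P₀ := by rw [← map_mul, ← hGH, hκ₀F]
  -- some `X_j`, `j ∈ T`, does not divide `G₀ = κ₀ G`
  have hA : ∃ j ∈ T, ¬ (κ₀ (MvPowerSeries.X j) ∣ κ₀ G) := by
    by_contra hall
    push Not at hall
    have hdvd : P₀ ∣ κ₀ G :=
      Finset.prod_dvd_of_forall_dvd_of_pairwise (fun c => κ₀ (MvPowerSeries.X c)) T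
        (fun c hc => by rw [hκ₀c c hc]; exact MvPowerSeries.prime_X' k _)
        (fun c hc c' hc' hcc' h => by
          rw [hκ₀c c hc, hκ₀c c' hc'] at h
          exact hcc' (congrArg Subtype.val (MvPowerSeries.X_dvd_X_iff.mp h)))
        hall
    obtain ⟨G₁, hG₁⟩ := hdvd
    have h1 : P₀ * (G₁ * κ₀ H) = P₀ * (-1) := by
      rw [← mul_assoc, ← hG₁, hGH₀, mul_neg_one]
    have h2 : G₁ * κ₀ H = -1 := mul_left_cancel₀ hP₀ne h1
    have h3 : IsUnit (κ₀ H) := IsUnit.of_mul_eq_one (-G₁) (by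
      rw [show κ₀ H * (-G₁) = -(G₁ * κ₀ H) by ring, h2, neg_neg])
    exact hH ((MvPowerSeries.isUnit_killCompl_iff e₀ H).mp h3)
  obtain ⟨j, hjT, hj⟩ := hA
  have hju : j ≠ u := fun h => huT (h ▸ hjT)
  have hjv : j ≠ v := fun h => hvT (h ▸ hjT)
  -- kill `X_j` instead: `Ḡ H̄ = X_u X_v`
  let e₁ : {c // c ≠ j} ↪ σ := Function.Embedding.subtype _
  let κ₁ := MvPowerSeries.killCompl (R := k) e₁
  let u' : {c // c ≠ j} := ⟨u, hju.symm⟩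
  let v' : {c // c ≠ j} := ⟨v, hjv.symm⟩
  have hκ₁u : κ₁ (MvPowerSeries.X u) = MvPowerSeries.X u' := MvPowerSeries.killCompl_X (e := e₁) u'
  have hκ₁v : κ₁ (MvPowerSeries.X v) = MvPowerSeries.X v' := MvPowerSeries.killCompl_X (e := e₁) v'
  have hκ₁F : κ₁ F = MvPowerSeries.X u' * MvPowerSeries.X v' := by
    rw [hF, map_sub, map_mul, hκ₁u, hκ₁v, map_prod,
      Finset.prod_eq_zero hjT (MvPowerSeries.killCompl_X_eq_zero (by rintro ⟨⟨c, hc⟩, h⟩; exact hc h)),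
      sub_zero]
  have hGH₁ : κ₁ G * κ₁ H = MvPowerSeries.X u' * MvPowerSeries.X v' := by
    rw [← map_mul, ← hGH, hκ₁F]
  have hu'v' : u' ≠ v' := fun h => huv (congrArg Subtype.val h)
  have pu := MvPowerSeries.prime_X' k u'
  have pv := MvPowerSeries.prime_X' k v'
  -- `X_u ∣ Ḡ` or `X_v ∣ Ḡ`
  have key : (MvPowerSeries.X u' : MvPowerSeries {c // c ≠ j} k) ∣ κ₁ G ∨
      (MvPowerSeries.X v' : MvPowerSeries {c // c ≠ j} k) ∣ κ₁ G := by
    rcases pu.dvd_or_dvd ⟨MvPowerSeries.X v', hGH₁⟩ with h | h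
    · exact Or.inl h
    rcases pv.dvd_or_dvd ⟨MvPowerSeries.X u', by rw [hGH₁, mul_comm]⟩ with h' | h'
    · exact Or.inr h'
    -- both divide `H̄`: then `Ḡ` is a unit
    exfalso
    obtain ⟨a, ha⟩ := h
    have hva : (MvPowerSeries.X v' : MvPowerSeries {c // c ≠ j} k) ∣ a := by
      rcases pv.dvd_or_dvd (ha ▸ h') with h'' | h''
      · exact absurd (MvPowerSeries.X_dvd_X_iff.mp h'') hu'v'.symm
      · exact h''
    obtain ⟨b, rfl⟩ := hva
    have h1 : MvPowerSeries.X u' * MvPowerSeries.X v' * (κ₁ G * b) =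
        MvPowerSeries.X u' * MvPowerSeries.X v' * 1 := by
      rw [mul_one]
      calc MvPowerSeries.X u' * MvPowerSeries.X v' * (κ₁ G * b)
          = κ₁ G * (MvPowerSeries.X u' * (MvPowerSeries.X v' * b)) := by ring
        _ = κ₁ G * κ₁ H := by rw [ha]
        _ = _ := hGH₁
    have hne : (MvPowerSeries.X u' * MvPowerSeries.X v' : MvPowerSeries {c // c ≠ j} k) ≠ 0 :=
      mul_ne_zero pu.ne_zero pv.ne_zero
    have h2 : κ₁ G * b = 1 := mul_left_cancel₀ hne h1
    exact hG ((MvPowerSeries.isUnit_killCompl_iff e₁ G).mp (IsUnit.of_mul_eq_one b h2))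
  -- kill `X_u, X_v` as well: `X_j ∣ G₀`, a contradiction
  let e' : {c // c ≠ u ∧ c ≠ v ∧ c ≠ j} ↪ {c // c ≠ j} :=
    ⟨fun c => ⟨c.1, c.2.2.2⟩, fun c c' h => Subtype.ext (congrArg Subtype.val h :)⟩
  let e'' : {c // c ≠ u ∧ c ≠ v ∧ c ≠ j} ↪ {c // c ≠ u ∧ c ≠ v} :=
    ⟨fun c => ⟨c.1, c.2.1, c.2.2.1⟩, fun c c' h => Subtype.ext (congrArg Subtype.val h :)⟩
  have hee : e'.trans e₁ = e''.trans e₀ := by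
    ext c
    rfl
  have hzero : MvPowerSeries.killCompl (R := k) e' (κ₁ G) = 0 := by
    rcases key with ⟨a, ha⟩ | ⟨a, ha⟩
    · rw [ha, map_mul, MvPowerSeries.killCompl_X_eq_zero (by rintro ⟨⟨c, hc⟩, h⟩; exact hc.1 (congrArg Subtype.val h)),
        zero_mul]
    · rw [ha, map_mul, MvPowerSeries.killCompl_X_eq_zero (by rintro ⟨⟨c, hc⟩, h⟩; exact hc.2.1 (congrArg Subtype.val h)),
        zero_mul]
  rw [show κ₁ G = MvPowerSeries.killCompl e₁ G from rfl, MvPowerSeries.killCompl_killCompl, hee,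
    ← MvPowerSeries.killCompl_killCompl] at hzero
  -- so `G₀ = κ₀ G` lies in the kernel `(X_j)` of killing `X_j`
  have hker : κ₀ G ∈ RingHom.ker (MvPowerSeries.killCompl (R := k) e'').toRingHom := hzero
  let j' : {c // c ≠ u ∧ c ≠ v} := ⟨j, hju, hjv⟩
  rw [MvPowerSeries.ker_killCompl_eq_span e'' {j'} (fun s => by
      simp only [Finset.mem_singleton, Set.mem_range, not_exists]
      constructor
      · rintro rfl ⟨c, hc⟩ h
        exact hc.2.2 (congrArg Subtype.val h)
      · intro h
        by_contra hs
        exact h ⟨s.1, s.2.1, s.2.2, fun h' => hs (Subtype.ext h')⟩ rfl),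
    Finset.coe_singleton, Set.image_singleton, Ideal.mem_span_singleton] at hker
  rw [hκ₀c j hjT] at hj
  exact hj hker

/-- **The relation `uv - t₁ ⋯ t_s` of de Jong 4.25 (ii) is a prime element of `k⟦u, v, t₁, …, t_m⟧`**,
for `1 ≤ s ≤ m`. [cite: DeJong1996, 4.25 (ii), p. 75] -/
theorem DeJong1996.prime_nodalFamilyRelation (m s : ℕ) (hs : 1 ≤ s) (hsm : s ≤ m) :
    Prime (DeJong1996.nodalFamilyRelation k m s) := by
  unfold DeJong1996.nodalFamilyRelation
  have h := MvPowerSeries.prime_X_mul_X_sub_prod k (Sum.inl 0 : Fin 2 ⊕ Fin m) (Sum.inl 1)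
    (by simp) ((Finset.univ.filter fun i : Fin m => i.val < s).map ⟨Sum.inr, Sum.inr_injective⟩)
    ⟨Sum.inr ⟨0, lt_of_lt_of_le hs hsm⟩, Finset.mem_map_of_mem _ (Finset.mem_filter.mpr
      ⟨Finset.mem_univ _, hs⟩)⟩
    (by simp) (by simp)
  rwa [Finset.prod_map] at h

/-- **The formal model `k⟦u, v, t₁, …, t_m⟧/(uv - t₁ ⋯ t_s)` is an integral domain**, for
`1 ≤ s ≤ m`. [cite: DeJong1996, 4.25 (ii), p. 75] -/
theorem DeJong1996.NodalFamilyRing.isDomain (m s : ℕ) (hs : 1 ≤ s) (hsm : s ≤ m) :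
    IsDomain (DeJong1996.NodalFamilyRing k m s) := by
  haveI := (Ideal.span_singleton_prime (DeJong1996.prime_nodalFamilyRelation k m s hs hsm).ne_zero).mpr
    (DeJong1996.prime_nodalFamilyRelation k m s hs hsm)
  exact Ideal.Quotient.isDomain _

end Prime

/-! ## Dimension and (non-)regularity of the formal model -/

namespace DeJong1996.NodalFamilyRing

variable (k : Type u) [Field k] (m s : ℕ)

/-- **`dim k⟦u, v, t₁, …, t_m⟧/(uv - t₁ ⋯ t_s) ≤ m + 1`.** [folklore] -/
theorem ringKrullDim_le : ringKrullDim (NodalFamilyRing k m s) ≤ (m + 1 : ℕ) := by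
  rw [← ringKrullDim_eq_of_ringEquiv (formalNodeRingEquivNodalFamilyRing k m s)]
  exact FormalNodeRing.ringKrullDim_le k m _

/-- **For `s ≥ 2` the formal model of 4.25 (ii) is not a regular local ring** ("`x` is a
singular point of `X`"): a regular ring of the shape `k⟦u, v, T⟧/(uv - ∏ Tᵢ^{νᵢ})` has a single
exponent `νᵢ = 1` (`FormalNodeRing.exists_eq_single_of_isRegularLocalRing`), while here
`ν₀ = ν₁ = 1`. [cite: DeJong1996, 4.25 (ii), p. 75] -/
theorem not_isRegularLocalRing (hs : 2 ≤ s) (hsm : s ≤ m) :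
    ¬ IsRegularLocalRing (NodalFamilyRing k m s) := by
  intro hreg
  obtain ⟨i₀, hi₀, -⟩ := FormalNodeRing.exists_eq_single_of_isRegularLocalRing
    (formalNodeRingEquivNodalFamilyRing k m s).symm
  have h0 := congrFun hi₀ ⟨0, by omega⟩
  have h1 := congrFun hi₀ ⟨1, by omega⟩
  simp only [show (0 : ℕ) < s by omega, show (1 : ℕ) < s by omega, ↓reduceIte] at h0 h1
  rw [Pi.single_apply] at h0 h1
  split_ifs at h0 with h0'
  split_ifs at h1 with h1'
  exact absurd (h0'.trans h1'.symm) (by simp [Fin.ext_iff])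

end DeJong1996.NodalFamilyRing

end Literature.AlgebraicGeometry.Resolution

end
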